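import Summits.AtomisticToContinuum.Crystallization.Theorems.FrustratedLawDichotomyStrainedPatchHomLeafTableCheck

/-!
# TABLE-DRIVEN ℕ-encoded (P4) hcp Gram-leaf checker `leafCheckH` (β2-hcp; critic rows 864 / 865)

decomp-a2c hand-2 g24 (crux `AperiodicFrustratedLawGap`, stmt-AtomisticToContinuum-27623).  DEFINITIONS ONLY (computable; no `noncomputable`,
no instances, no notation): the hcp twin of hand-1's v2 fcc leaf checker `…HomLeafTableCheck.leafCheck`.  The `q`-table (`Row`, `QT`, `QT.findLE`,
`Row.ok`), the sign–magnitude helpers (`sgnZ`, `addP`, `addN`, `sx`, `absDiff`) and the scale literals (`SCN`) are hand-1's, REUSED AS IS — the table is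
label-agnostic (rows certify `φ = W₄₅ ∘ √` on `q`-intervals), so the fcc table `qTable` and any successor (v3 window rows) serve the hcp leaf unchanged.

What is hcp-specific (two-sublattice family, `f = hexFrame`, `t = hcpShift + ξ`):

* TEN coordinate CLASSES `x₀ … x₉ = (g₀₀, g₁₁, g₂₂, g₀₁+g₁₀, g₀₂+g₂₀, g₁₂+g₂₁, h₀, h₁, h₂, τ)` of the 13 extended Gram data
  `gᵢⱼ = ⟪U fᵢ, U fⱼ⟫`, `hᵢ = ⟪U fᵢ, U t⟫`, `τ = ‖U t‖²`; the squared length of a term is the INTEGER functional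
  `ℓ_v = Σⱼ L_vⱼ xⱼ` with `L_v = (b₀², b₁², b₂², b₀b₁, b₀b₂, b₁b₂, 0, 0, 0, 0)` (unshifted label `b`, term `‖latPt U f b‖²`) and
  `L_v = (b₀², b₁², b₂², b₀b₁, b₀b₂, b₁b₂, 2b₀, 2b₁, 2b₂, 1)` (shifted label `b`, term `‖latPt U f b + U t‖²`).
* `NH` — a near-label record of EITHER family: label, the six `|bᵢbⱼ|` with sign bits (as hand-1's `NL`), the three linear magnitudes `aᵢ`
  (`= 2|bᵢ|` shifted, `0` unshifted) with sign bits, and the constant coefficient `u ∈ {0, 1}`; `NH.ok` re-derives all of them from `(fam, b)`.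
* `LH` — the per-leaf class data: SIGNED class centres (magnitude `cⱼ`, sign bit `sⱼ`; the cross data `hᵢ` and the off-diagonal Gram sums do change
  sign inside the root cube) and class half-widths `wⱼ`, scale `SC`.
* `AccH` / `step*H` / `foldH` / `finalH` / `leafCheckH` — the per-label fold with sign-split accumulators and TEN gradient classes; ONE list carries
  both families (so the first-order gradient cancellation between the families is kept SIGNED); no stop norm (the list is exactly the set of labels
  that can be near somewhere in the root cube; leaf-wise far labels are skipped by the box test of `step2H`).  Final inequality = hand-1's, × `SC³`.

Semantics and soundness: companion modules (`…HomLeafTableFoldHcp`, `…HomLeafTableSoundHcp`).  `--supports stmt-AtomisticToContinuum-27623`.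
-/

namespace Summit.AtomisticToContinuum.Crystallization.Theorems.FrustratedLawDichotomyStrainedPatchHomLeafTableCheckHcp

open Summit.AtomisticToContinuum.Crystallization.Theorems.FrustratedLawDichotomyStrainedPatchHomLeafTableCheck
  (Row QT sgnZ SCN addP addN sx absDiff)

/-! ## §1. Near-label records (both families) -/

/-- A near-label record of the hcp two-sublattice family.  `fam = false`: unshifted term `‖latPt U f b‖`; `fam = true`: shifted term
`‖latPt U f b + U t‖`.  Precomputed: `mᵢⱼ = |bᵢbⱼ|` with sign bits `sᵢⱼ`, linear magnitudes `aᵢ` (`2|bᵢ|` or `0`) with sign bits `zᵢ`, constant `u`. -/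
structure NH where
  /-- family bit (`true` = shifted) -/
  fam : Bool
  /-- the label -/
  b0 : ℤ
  /-- the label -/
  b1 : ℤ
  /-- the label -/
  b2 : ℤ
  /-- `b0²` -/
  m00 : ℕ
  /-- `b1²` -/
  m11 : ℕ
  /-- `b2²` -/
  m22 : ℕ
  /-- `|b0 b1|` -/
  m01 : ℕ
  /-- `|b0 b2|` -/
  m02 : ℕ
  /-- `|b1 b2|` -/
  m12 : ℕ
  /-- `b0 b1 < 0` -/
  s01 : Bool
  /-- `b0 b2 < 0` -/
  s02 : Bool
  /-- `b1 b2 < 0` -/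
  s12 : Bool
  /-- `|2 b0|` (shifted) or `0` -/
  a0 : ℕ
  /-- `|2 b1|` (shifted) or `0` -/
  a1 : ℕ
  /-- `|2 b2|` (shifted) or `0` -/
  a2 : ℕ
  /-- `b0 < 0` (shifted; `false` otherwise) -/
  z0 : Bool
  /-- `b1 < 0` -/
  z1 : Bool
  /-- `b2 < 0` -/
  z2 : Bool
  /-- constant coefficient: `1` (shifted) or `0` -/
  u : ℕ

/-- The family bit as an integer factor. -/
def famZ : Bool → ℤ
  | true => 1
  | false => 0

/-- Consistency of the precomputed fields with `(fam, b)` (checked once over the literal list). -/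
def NH.ok (l : NH) : Bool :=
  decide ((l.m00 : ℤ) = l.b0 * l.b0) && decide ((l.m11 : ℤ) = l.b1 * l.b1) && decide ((l.m22 : ℤ) = l.b2 * l.b2) &&
    decide (sgnZ l.s01 l.m01 = l.b0 * l.b1) && decide (sgnZ l.s02 l.m02 = l.b0 * l.b2) && decide (sgnZ l.s12 l.m12 = l.b1 * l.b2) &&
    decide (sgnZ l.z0 l.a0 = famZ l.fam * (2 * l.b0)) && decide (sgnZ l.z1 l.a1 = famZ l.fam * (2 * l.b1)) &&
    decide (sgnZ l.z2 l.a2 = famZ l.fam * (2 * l.b2)) && decide ((l.u : ℤ) = famZ l.fam)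

/-! ## §2. Per-leaf class data -/

/-- The per-leaf constants of the hot loop: the ten SIGNED class centres (magnitudes `cⱼ`, sign bits `sⱼ`, `true` = negative) and class
half-widths `wⱼ`, classes `(00, 11, 22, 01+10, 02+20, 12+21, h0, h1, h2, τ)`, scale `SC`. -/
structure LH where
  /-- `|centre|` class `00` -/
  c0 : ℕ
  /-- class `11` -/
  c1 : ℕ
  /-- class `22` -/
  c2 : ℕ
  /-- class `01+10` -/
  c3 : ℕ
  /-- class `02+20` -/
  c4 : ℕ
  /-- class `12+21` -/
  c5 : ℕ
  /-- class `h0` -/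
  c6 : ℕ
  /-- class `h1` -/
  c7 : ℕ
  /-- class `h2` -/
  c8 : ℕ
  /-- class `τ` -/
  c9 : ℕ
  /-- sign of centre, class `00` -/
  s0 : Bool
  /-- sign `11` -/
  s1 : Bool
  /-- sign `22` -/
  s2 : Bool
  /-- sign `01+10` -/
  s3 : Bool
  /-- sign `02+20` -/
  s4 : Bool
  /-- sign `12+21` -/
  s5 : Bool
  /-- sign `h0` -/
  s6 : Bool
  /-- sign `h1` -/
  s7 : Bool
  /-- sign `h2` -/
  s8 : Bool
  /-- sign `τ` -/
  s9 : Bool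
  /-- half-width class `00` -/
  w0 : ℕ
  /-- `11` -/
  w1 : ℕ
  /-- `22` -/
  w2 : ℕ
  /-- `01+10` -/
  w3 : ℕ
  /-- `02+20` -/
  w4 : ℕ
  /-- `12+21` -/
  w5 : ℕ
  /-- `h0` -/
  w6 : ℕ
  /-- `h1` -/
  w7 : ℕ
  /-- `h2` -/
  w8 : ℕ
  /-- `τ` -/
  w9 : ℕ

/-! ## §3. The accumulator and the per-label step -/

/-- Fold state (all naturals; `P`/`N` = positive/negative parts; ten gradient classes). -/
structure AccH where
  /-- no range / lookup failure so far -/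
  ok : Bool
  /-- `Σ V⁺` -/
  vP : ℕ
  /-- `Σ V⁻` -/
  vN : ℕ
  /-- `Σ (D δ)⁺` -/
  dP : ℕ
  /-- `Σ (D δ)⁻` -/
  dN : ℕ
  /-- `Σ δ` -/
  sd : ℕ
  /-- gradient class `00` `+` -/
  g0P : ℕ
  /-- class `00` `−` -/
  g0N : ℕ
  /-- class `11` -/
  g1P : ℕ
  /-- class `11` -/
  g1N : ℕ
  /-- class `22` -/
  g2P : ℕ
  /-- class `22` -/
  g2N : ℕ
  /-- class `01+10` -/
  g3P : ℕ
  /-- class `01+10` -/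
  g3N : ℕ
  /-- class `02+20` -/
  g4P : ℕ
  /-- class `02+20` -/
  g4N : ℕ
  /-- class `12+21` -/
  g5P : ℕ
  /-- class `12+21` -/
  g5N : ℕ
  /-- class `h0` -/
  g6P : ℕ
  /-- class `h0` -/
  g6N : ℕ
  /-- class `h1` -/
  g7P : ℕ
  /-- class `h1` -/
  g7N : ℕ
  /-- class `h2` -/
  g8P : ℕ
  /-- class `h2` -/
  g8N : ℕ
  /-- class `τ` -/
  g9P : ℕ
  /-- class `τ` -/
  g9N : ℕ
  /-- `Σ M (δ + r)²` -/
  cur : ℕ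

/-- The empty accumulator. -/
def accH0 : AccH := ⟨true, 0, 0, 0, 0, 0, 0, 0, 0, 0, 0, 0, 0, 0, 0, 0, 0, 0, 0, 0, 0, 0, 0, 0, 0, 0, 0⟩

/-- Mark failure (fields kept). -/
def AccH.fail (a : AccH) : AccH :=
  ⟨false, a.vP, a.vN, a.dP, a.dN, a.sd, a.g0P, a.g0N, a.g1P, a.g1N, a.g2P, a.g2N, a.g3P, a.g3N, a.g4P, a.g4N, a.g5P, a.g5N,
   a.g6P, a.g6N, a.g7P, a.g7N, a.g8P, a.g8N, a.g9P, a.g9N, a.cur⟩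

/-- Positive part of the label's centre value `q0 = Σⱼ L_vⱼ · (±cⱼ)` (sign of a product = xor of the two sign bits). -/
def qPosH (k : LH) (l : NH) : ℕ :=
  addP k.s0 (Nat.mul l.m00 k.c0) (addP k.s1 (Nat.mul l.m11 k.c1) (addP k.s2 (Nat.mul l.m22 k.c2)
    (addP (sx l.s01 k.s3) (Nat.mul l.m01 k.c3) (addP (sx l.s02 k.s4) (Nat.mul l.m02 k.c4) (addP (sx l.s12 k.s5) (Nat.mul l.m12 k.c5)
      (addP (sx l.z0 k.s6) (Nat.mul l.a0 k.c6) (addP (sx l.z1 k.s7) (Nat.mul l.a1 k.c7) (addP (sx l.z2 k.s8) (Nat.mul l.a2 k.c8)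
        (addP k.s9 (Nat.mul l.u k.c9) 0)))))))))

/-- Negative part of `q0`. -/
def qNegH (k : LH) (l : NH) : ℕ :=
  addN k.s0 (Nat.mul l.m00 k.c0) (addN k.s1 (Nat.mul l.m11 k.c1) (addN k.s2 (Nat.mul l.m22 k.c2)
    (addN (sx l.s01 k.s3) (Nat.mul l.m01 k.c3) (addN (sx l.s02 k.s4) (Nat.mul l.m02 k.c4) (addN (sx l.s12 k.s5) (Nat.mul l.m12 k.c5)
      (addN (sx l.z0 k.s6) (Nat.mul l.a0 k.c6) (addN (sx l.z1 k.s7) (Nat.mul l.a1 k.c7) (addN (sx l.z2 k.s8) (Nat.mul l.a2 k.c8)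
        (addN k.s9 (Nat.mul l.u k.c9) 0)))))))))

/-- The label's range radius `r = Σⱼ |L_vⱼ| wⱼ`. -/
def radH (k : LH) (l : NH) : ℕ :=
  Nat.add (Nat.add (Nat.add (Nat.add (Nat.mul l.m00 k.w0) (Nat.mul l.m11 k.w1)) (Nat.mul l.m22 k.w2))
    (Nat.add (Nat.add (Nat.mul l.m01 k.w3) (Nat.mul l.m02 k.w4)) (Nat.mul l.m12 k.w5)))
    (Nat.add (Nat.add (Nat.add (Nat.mul l.a0 k.w6) (Nat.mul l.a1 k.w7)) (Nat.mul l.a2 k.w8)) (Nat.mul l.u k.w9))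

/-- Step 4: accumulate the row's data for this label (`δ = q0 − t ≥ 0`, `r` the radius). -/
def step4H (a : AccH) (l : NH) (r : ℕ) (row : Row) (δ : ℕ) : AccH :=
  ⟨a.ok, addP row.sV row.aV a.vP, addN row.sV row.aV a.vN,
   addP row.sD (Nat.mul row.aD δ) a.dP, addN row.sD (Nat.mul row.aD δ) a.dN, Nat.add a.sd δ,
   addP row.sD (Nat.mul row.aD l.m00) a.g0P, addN row.sD (Nat.mul row.aD l.m00) a.g0N,
   addP row.sD (Nat.mul row.aD l.m11) a.g1P, addN row.sD (Nat.mul row.aD l.m11) a.g1N,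
   addP row.sD (Nat.mul row.aD l.m22) a.g2P, addN row.sD (Nat.mul row.aD l.m22) a.g2N,
   addP (sx row.sD l.s01) (Nat.mul row.aD l.m01) a.g3P, addN (sx row.sD l.s01) (Nat.mul row.aD l.m01) a.g3N,
   addP (sx row.sD l.s02) (Nat.mul row.aD l.m02) a.g4P, addN (sx row.sD l.s02) (Nat.mul row.aD l.m02) a.g4N,
   addP (sx row.sD l.s12) (Nat.mul row.aD l.m12) a.g5P, addN (sx row.sD l.s12) (Nat.mul row.aD l.m12) a.g5N,
   addP (sx row.sD l.z0) (Nat.mul row.aD l.a0) a.g6P, addN (sx row.sD l.z0) (Nat.mul row.aD l.a0) a.g6N,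
   addP (sx row.sD l.z1) (Nat.mul row.aD l.a1) a.g7P, addN (sx row.sD l.z1) (Nat.mul row.aD l.a1) a.g7N,
   addP (sx row.sD l.z2) (Nat.mul row.aD l.a2) a.g8P, addN (sx row.sD l.z2) (Nat.mul row.aD l.a2) a.g8N,
   addP row.sD (Nat.mul row.aD l.u) a.g9P, addN row.sD (Nat.mul row.aD l.u) a.g9N,
   Nat.add a.cur (Nat.mul row.M (Nat.mul (Nat.add δ r) (Nat.add δ r)))⟩

/-- Step 3: the looked-up row must cover the label's range `[q0 − r, q0 + r]` and lie left of `q0`. -/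
def step3H (a : AccH) (l : NH) (q r : ℕ) : Option Row → AccH
  | none => a.fail
  | some row =>
    match Nat.ble row.A (Nat.sub q r) && Nat.ble (Nat.add q r) row.B && Nat.ble row.t q with
    | true => step4H a l r row (Nat.sub q row.t)
    | false => a.fail

/-- Step 2: a label whose whole range lies beyond `81/4` is FAR for this box (contributes `0`); otherwise look it up. -/
def step2H (tab : QT) (a : AccH) (l : NH) (q r : ℕ) : AccH :=
  match Nat.ble (Nat.mul 81 SCN) (Nat.mul 4 (Nat.sub q r)) with
  | true => a
  | false => step3H a l q r (QT.findLE q tab none)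

/-- Step 1: `q0 = qPos − qNeg` must be a natural number at least `r`. -/
def step1H (tab : QT) (a : AccH) (l : NH) (qP qN r : ℕ) : AccH :=
  match Nat.ble (Nat.add qN r) qP with
  | true => step2H tab a l (Nat.sub qP qN) r
  | false => a.fail

/-- The per-label step. -/
def stepH (tab : QT) (k : LH) (a : AccH) (l : NH) : AccH :=
  step1H tab a l (qPosH k l) (qNegH k l) (radH k l)

/-- The fold over the near-label list (both families; no stop norm). -/
def foldH (tab : QT) (k : LH) : AccH → List NH → AccH
  | a, [] => a
  | a, l :: ls => foldH tab k (stepH tab k a l) ls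

/-! ## §4. The final inequality (× `SC³`) -/

/-- Gradient penalty `Σⱼ (|gⱼ| + E·Aⱼ)·wⱼ` over the ten classes (`Aⱼ = Σ_labels |L_vⱼ|`). -/
def gradPenH (E A0 A1 A2 A3 A4 A5 A6 A7 A8 A9 : ℕ) (k : LH) (a : AccH) : ℕ :=
  Nat.add
    (Nat.add (Nat.add (Nat.add (Nat.mul (Nat.add (absDiff a.g0P a.g0N) (Nat.mul E A0)) k.w0)
      (Nat.mul (Nat.add (absDiff a.g1P a.g1N) (Nat.mul E A1)) k.w1))
      (Nat.mul (Nat.add (absDiff a.g2P a.g2N) (Nat.mul E A2)) k.w2))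
      (Nat.add (Nat.add (Nat.mul (Nat.add (absDiff a.g3P a.g3N) (Nat.mul E A3)) k.w3)
      (Nat.mul (Nat.add (absDiff a.g4P a.g4N) (Nat.mul E A4)) k.w4))
      (Nat.mul (Nat.add (absDiff a.g5P a.g5N) (Nat.mul E A5)) k.w5)))
    (Nat.add (Nat.add (Nat.add (Nat.mul (Nat.add (absDiff a.g6P a.g6N) (Nat.mul E A6)) k.w6)
      (Nat.mul (Nat.add (absDiff a.g7P a.g7N) (Nat.mul E A7)) k.w7))
      (Nat.mul (Nat.add (absDiff a.g8P a.g8N) (Nat.mul E A8)) k.w8))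
      (Nat.mul (Nat.add (absDiff a.g9P a.g9N) (Nat.mul E A9)) k.w9))

/-- Left side: `μ⁺SC² + 2(SC²·vN + SC·dN + SC·E·Σδ + SC·G) + cur`. -/
def lhsH (E : ℕ) (μP G : ℕ) (a : AccH) : ℕ :=
  Nat.add (Nat.add (Nat.mul μP (Nat.mul SCN SCN))
    (Nat.mul 2 (Nat.add (Nat.add (Nat.add (Nat.mul (Nat.mul SCN SCN) a.vN) (Nat.mul SCN a.dN)) (Nat.mul (Nat.mul SCN E) a.sd))
      (Nat.mul SCN G)))) a.cur

/-- Right side: `μ⁻SC² + 2(SC²·vP + SC·dP)`. -/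
def rhsH (μN : ℕ) (a : AccH) : ℕ :=
  Nat.add (Nat.mul μN (Nat.mul SCN SCN)) (Nat.mul 2 (Nat.add (Nat.mul (Nat.mul SCN SCN) a.vP) (Nat.mul SCN a.dP)))

/-- Final verdict from the accumulator. -/
def finalH (E A0 A1 A2 A3 A4 A5 A6 A7 A8 A9 : ℕ) (k : LH) (sμ : Bool) (aμ : ℕ) (a : AccH) : Bool :=
  a.ok && Nat.ble (lhsH E (addP sμ aμ 0) (gradPenH E A0 A1 A2 A3 A4 A5 A6 A7 A8 A9 k a) a) (rhsH (addN sμ aμ 0) a)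

/-- ★ **THE hcp TABLE LEAF CHECK**: table `tab` (certified once: `tab.allOK E`), near-label list `labs` of both families (certified once), derivative
half-width `E`, the ten class sums `Aⱼ` of the list, the class data `k` of the leaf, and the target `μ = ∓aμ` (sign bit `sμ`). -/
def leafCheckH (tab : QT) (labs : List NH) (E A0 A1 A2 A3 A4 A5 A6 A7 A8 A9 : ℕ) (k : LH) (sμ : Bool) (aμ : ℕ) : Bool :=
  finalH E A0 A1 A2 A3 A4 A5 A6 A7 A8 A9 k sμ aμ (foldH tab k accH0 labs)

end Summit.AtomisticToContinuum.Crystallization.Theorems.FrustratedLawDichotomyStrainedPatchHomLeafTableCheckHcp
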